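import Literature.Probability.Percolation.DualContours
import HarnessLib

/-!
# Transplant sharpness VII — mesh-`M` cells of `ℤ²`: interiors, plaquettes, relative coordinates

builds on p205010 (kernel theorem, internal audit signed; external expert review pending).
Status sentence (coordinator 2026-08-20T04:30Z): "θ(p_c) = 0 on ℤ^d, all d ≥ 2 — kernel-verified (Lean 4/Mathlib,
standard axioms); internal adversarial audit SIGNED 2026-08-20 04:29Z; external expert review pending."

Lane `prim-bschramm`, seat p5 (sharpness); memo `run/shared/lean/prim/bschramm/prim-bschramm-p5-g19/GRIDWEDGE-PROOF.md`
§4.2 and §7 (M1).  Part of module (M1) of the kernel route for the hard half of P5-SHARPNESS row 83 (the gridded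
log-wedge `ℤ²[W ∪ L_M]` has the wedge's critical point).  Everything here is deterministic planar bookkeeping for the
square lattice and PROVED.

* `crossedEdge_right/_up/_left/_down` — the four dual steps of `ℤ²` explicitly (tree convention `crossedEdge`);
* `cellInterior M c`, `cellFaces M c` — the interior lattice points and the plaquettes of the `M × M` cell with
  lower-left corner `M c`; `not_mem_of_clear` — in a cell CLEAR for `ω` (no edge of `ω` has an endpoint inside it; for
  the gridded wedge every hole is clear for `ω ∩ E(ℤ²[W ∪ L_M])`) an edge with an interior endpoint is not in `ω`;
* relative coordinates `M c + (i, j)`: membership criteria for interiors / plaquettes of `c`, `c + e₀`, `c + e₁`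
  (`base_add_mem_cellInterior_iff`, …), the crossed edges of the four steps from `M c + (i, j)`
  (`crossedEdge_base_right`, …) and positions after straight runs (`base_add_smul_right`, …).

Companions: `SharpnessGridCoarse.lean` (walls, coarse configuration), `SharpnessGridPassage.lean` (realisation).

References: G. Grimmett, *Percolation*, 2nd ed. (1999), §1.4 pp. 16–17 (dual lattice, plaquettes).
-/

namespace Summit.CriticalPhenomena.PercolationContinuityZ3.Theorems.TransplantSharpness

open Literature.Probability.Percolation Literature.Probability.LatticeModels

/-! ## The four dual steps of `ℤ²` explicitly -/


/-- The edge crossed by the dual step to the RIGHT from plaquette `a`: the vertical edge above `a + e₀`. [folklore] -/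
theorem crossedEdge_right (a : Site 2) :
    crossedEdge a (0, true) = s(a + Pi.single 0 1, a + Pi.single 0 1 + Pi.single 1 1) := by
  simp [crossedEdge]

/-- The edge crossed by the dual step UP from plaquette `a`: the horizontal edge right of `a + e₁`. [folklore] -/
theorem crossedEdge_up (a : Site 2) :
    crossedEdge a (1, true) = s(a + Pi.single 1 1, a + Pi.single 1 1 + Pi.single 0 1) := by
  simp [crossedEdge, show (1 : Fin 2).rev = 0 from by decide]

/-- The edge crossed by the dual step to the LEFT from plaquette `a`: the vertical edge above `a`. [folklore] -/
theorem crossedEdge_left (a : Site 2) :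
    crossedEdge a (0, false) = s(a, a + Pi.single 1 1) := by
  simp [crossedEdge]

/-- The edge crossed by the dual step DOWN from plaquette `a`: the horizontal edge right of `a`. [folklore] -/
theorem crossedEdge_down (a : Site 2) :
    crossedEdge a (1, false) = s(a, a + Pi.single 0 1) := by
  simp [crossedEdge, show (1 : Fin 2).rev = 0 from by decide]


/-! ## Cells, their plaquettes and interiors; clear cells -/

/-- The INTERIOR lattice points of the `M × M` cell with lower-left corner `M c`. House notation (GRIDWEDGE-PROOF §4.2). -/
def cellInterior (M : ℕ) (c : Site 2) : Set (Site 2) :=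
  {v | ∀ k : Fin 2, (M : ℤ) * c k < v k ∧ v k < (M : ℤ) * c k + M}

/-- The PLAQUETTES of the cell with lower-left corner `M c` (lower-left corners `a` with `M c_k ≤ a_k ≤ M c_k + M - 1`).
House notation (GRIDWEDGE-PROOF §4.2). -/
def cellFaces (M : ℕ) (c : Site 2) : Set (Site 2) :=
  {a | ∀ k : Fin 2, (M : ℤ) * c k ≤ a k ∧ a k ≤ (M : ℤ) * c k + M - 1}

/-- A cell is CLEAR for `ω` when no edge of `ω` has an endpoint in its interior, written out as
`∀ e ∈ ω, ∀ v ∈ e, v ∉ cellInterior M c` (for the gridded wedge every hole is clear for `ω ∩ E(ℤ²[W ∪ L_M])`);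
in a clear cell an edge with an interior endpoint is not in `ω`. [folklore] -/
theorem not_mem_of_clear {ω : BondConfig (Site 2)} {M : ℕ} {c : Site 2}
    (hc : ∀ e ∈ ω, ∀ v ∈ e, v ∉ cellInterior M c)
    {p q : Site 2} (h : p ∈ cellInterior M c ∨ q ∈ cellInterior M c) : s(p, q) ∉ ω := by
  intro he
  rcases h with h | h
  · exact hc _ he p (Sym2.mem_mk_left p q) h
  · exact hc _ he q (Sym2.mem_mk_right p q) h


/-! ## Coordinates relative to a cell -/

/-- Coordinates of `M c + (i, j)`. [folklore] -/
theorem base_add_apply_zero (M : ℕ) (c : Site 2) (i j : ℤ) : ((M : ℤ) • c + ![i, j]) 0 = M * c 0 + i := by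
  simp only [Pi.add_apply, Pi.smul_apply, smul_eq_mul, Matrix.cons_val_zero]
/-- Coordinates of `M c + (i, j)`. [folklore] -/
theorem base_add_apply_one (M : ℕ) (c : Site 2) (i j : ℤ) : ((M : ℤ) • c + ![i, j]) 1 = M * c 1 + j := by
  simp only [Pi.add_apply, Pi.smul_apply, smul_eq_mul, Matrix.cons_val_zero, Matrix.cons_val_one]

/-- Offsets add. [folklore] -/
theorem base_add_add (M : ℕ) (c : Site 2) (i j i' j' : ℤ) :
    (M : ℤ) • c + ![i, j] + ![i', j'] = (M : ℤ) • c + ![i + i', j + j'] := by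
  ext k; fin_cases k <;> simp only [Pi.add_apply, Pi.smul_apply, smul_eq_mul, Matrix.cons_val_zero, Matrix.cons_val_one, Fin.zero_eta, Fin.mk_one] <;> ring

/-- The unit steps as offsets. [folklore] -/
theorem smul_stepVec_right (r : ℤ) : r • stepVec ((0 : Fin 2), true) = ![r, 0] := by
  ext k; fin_cases k <;> simp [stepVec]
/-- The unit steps as offsets. [folklore] -/
theorem smul_stepVec_up (r : ℤ) : r • stepVec ((1 : Fin 2), true) = ![0, r] := by
  ext k; fin_cases k <;> simp [stepVec]
/-- The unit steps as offsets. [folklore] -/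
theorem smul_stepVec_down (r : ℤ) : r • stepVec ((1 : Fin 2), false) = ![0, -r] := by
  ext k; fin_cases k <;> simp [stepVec]
/-- The unit steps as offsets. [folklore] -/
theorem smul_stepVec_left (r : ℤ) : r • stepVec ((0 : Fin 2), false) = ![-r, 0] := by
  ext k; fin_cases k <;> simp [stepVec]
/-- `M c + (0,0) = M c`. [folklore] -/
theorem base_add_zero (M : ℕ) (c : Site 2) : (M : ℤ) • c + ![0, 0] = (M : ℤ) • c := by
  ext k; fin_cases k <;> simp
/-- The base point of the right neighbour cell: `M (c + e₀) = M c + (M, 0)`. [folklore] -/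
theorem base_right (M : ℕ) (c : Site 2) : (M : ℤ) • (c + Pi.single 0 1) = (M : ℤ) • c + ![(M : ℤ), 0] := by
  ext k; fin_cases k <;> simp [Pi.smul_apply, mul_add]
/-- The base point of the upper neighbour cell: `M (c + e₁) = M c + (0, M)`. [folklore] -/
theorem base_up (M : ℕ) (c : Site 2) : (M : ℤ) • (c + Pi.single 1 1) = (M : ℤ) • c + ![0, (M : ℤ)] := by
  ext k; fin_cases k <;> simp [Pi.smul_apply, mul_add]

/-- Interior points of the cell `c` in relative coordinates. [folklore] -/
theorem base_add_mem_cellInterior_iff {M : ℕ} {c : Site 2} {i j : ℤ} :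
    (M : ℤ) • c + ![i, j] ∈ cellInterior M c ↔ 0 < i ∧ i < M ∧ 0 < j ∧ j < M := by
  simp only [cellInterior, Set.mem_setOf_eq, Fin.forall_fin_two, Pi.add_apply, Pi.smul_apply, smul_eq_mul, Matrix.cons_val_zero, Matrix.cons_val_one]
  omega

/-- Interior points of the right neighbour cell in coordinates relative to `c`. [folklore] -/
theorem base_add_mem_cellInterior_right_iff {M : ℕ} {c : Site 2} {i j : ℤ} :
    (M : ℤ) • c + ![i, j] ∈ cellInterior M (c + Pi.single 0 1) ↔ (M : ℤ) < i ∧ i < 2 * M ∧ 0 < j ∧ j < M := by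
  simp only [cellInterior, Set.mem_setOf_eq, Fin.forall_fin_two, Pi.add_apply, Pi.smul_apply, smul_eq_mul, Matrix.cons_val_zero, Matrix.cons_val_one, Pi.single_eq_same,
    Pi.single_eq_of_ne (one_ne_zero : (1 : Fin 2) ≠ 0), mul_add, mul_one]
  omega

/-- Interior points of the upper neighbour cell in coordinates relative to `c`. [folklore] -/
theorem base_add_mem_cellInterior_up_iff {M : ℕ} {c : Site 2} {i j : ℤ} :
    (M : ℤ) • c + ![i, j] ∈ cellInterior M (c + Pi.single 1 1) ↔ 0 < i ∧ i < M ∧ (M : ℤ) < j ∧ j < 2 * M := by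
  simp only [cellInterior, Set.mem_setOf_eq, Fin.forall_fin_two, Pi.add_apply, Pi.smul_apply, smul_eq_mul, Matrix.cons_val_zero, Matrix.cons_val_one, Pi.single_eq_same,
    Pi.single_eq_of_ne (zero_ne_one : (0 : Fin 2) ≠ 1), mul_add, mul_one]
  omega

/-- Plaquettes of the cell `c` in relative coordinates. [folklore] -/
theorem base_add_mem_cellFaces_iff {M : ℕ} {c : Site 2} {i j : ℤ} :
    (M : ℤ) • c + ![i, j] ∈ cellFaces M c ↔ 0 ≤ i ∧ i ≤ (M : ℤ) - 1 ∧ 0 ≤ j ∧ j ≤ (M : ℤ) - 1 := by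
  simp only [cellFaces, Set.mem_setOf_eq, Fin.forall_fin_two, Pi.add_apply, Pi.smul_apply, smul_eq_mul, Matrix.cons_val_zero, Matrix.cons_val_one]
  omega

/-- Plaquettes of the right neighbour cell in relative coordinates. [folklore] -/
theorem base_add_mem_cellFaces_right_iff {M : ℕ} {c : Site 2} {i j : ℤ} :
    (M : ℤ) • c + ![i, j] ∈ cellFaces M (c + Pi.single 0 1) ↔
      (M : ℤ) ≤ i ∧ i ≤ 2 * M - 1 ∧ 0 ≤ j ∧ j ≤ (M : ℤ) - 1 := by
  simp only [cellFaces, Set.mem_setOf_eq, Fin.forall_fin_two, Pi.add_apply, Pi.smul_apply, smul_eq_mul, Matrix.cons_val_zero, Matrix.cons_val_one, Pi.single_eq_same,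
    Pi.single_eq_of_ne (one_ne_zero : (1 : Fin 2) ≠ 0), mul_add, mul_one]
  omega

/-- Plaquettes of the upper neighbour cell in relative coordinates. [folklore] -/
theorem base_add_mem_cellFaces_up_iff {M : ℕ} {c : Site 2} {i j : ℤ} :
    (M : ℤ) • c + ![i, j] ∈ cellFaces M (c + Pi.single 1 1) ↔
      0 ≤ i ∧ i ≤ (M : ℤ) - 1 ∧ (M : ℤ) ≤ j ∧ j ≤ 2 * M - 1 := by
  simp only [cellFaces, Set.mem_setOf_eq, Fin.forall_fin_two, Pi.add_apply, Pi.smul_apply, smul_eq_mul, Matrix.cons_val_zero, Matrix.cons_val_one, Pi.single_eq_same,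
    Pi.single_eq_of_ne (zero_ne_one : (0 : Fin 2) ≠ 1), mul_add, mul_one]
  omega


/-- Crossed edge of the step RIGHT from the plaquette `M c + (i, j)`. [folklore] -/
theorem crossedEdge_base_right (M : ℕ) (c : Site 2) (i j : ℤ) :
    crossedEdge ((M : ℤ) • c + ![i, j]) (0, true) = s((M : ℤ) • c + ![i + 1, j], (M : ℤ) • c + ![i + 1, j + 1]) := by
  rw [crossedEdge_right, show (Pi.single 0 1 : Site 2) = ![1, 0] from by ext k; fin_cases k <;> simp,
    show (Pi.single 1 1 : Site 2) = ![0, 1] from by ext k; fin_cases k <;> simp, base_add_add, base_add_add, add_zero, add_zero]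

/-- Crossed edge of the step UP from the plaquette `M c + (i, j)`. [folklore] -/
theorem crossedEdge_base_up (M : ℕ) (c : Site 2) (i j : ℤ) :
    crossedEdge ((M : ℤ) • c + ![i, j]) (1, true) = s((M : ℤ) • c + ![i, j + 1], (M : ℤ) • c + ![i + 1, j + 1]) := by
  rw [crossedEdge_up, show (Pi.single 0 1 : Site 2) = ![1, 0] from by ext k; fin_cases k <;> simp,
    show (Pi.single 1 1 : Site 2) = ![0, 1] from by ext k; fin_cases k <;> simp, base_add_add, base_add_add, add_zero, add_zero]

/-- Crossed edge of the step DOWN from the plaquette `M c + (i, j)`. [folklore] -/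
theorem crossedEdge_base_down (M : ℕ) (c : Site 2) (i j : ℤ) :
    crossedEdge ((M : ℤ) • c + ![i, j]) (1, false) = s((M : ℤ) • c + ![i, j], (M : ℤ) • c + ![i + 1, j]) := by
  rw [crossedEdge_down, show (Pi.single 0 1 : Site 2) = ![1, 0] from by ext k; fin_cases k <;> simp, base_add_add, add_zero]

/-- Crossed edge of the step LEFT from the plaquette `M c + (i, j)`. [folklore] -/
theorem crossedEdge_base_left (M : ℕ) (c : Site 2) (i j : ℤ) :
    crossedEdge ((M : ℤ) • c + ![i, j]) (0, false) = s((M : ℤ) • c + ![i, j], (M : ℤ) • c + ![i, j + 1]) := by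
  rw [crossedEdge_left, show (Pi.single 1 1 : Site 2) = ![0, 1] from by ext k; fin_cases k <;> simp, base_add_add, add_zero]

/-- Position after `r` steps RIGHT from `M c + (i, j)`. [folklore] -/
theorem base_add_smul_right (M : ℕ) (c : Site 2) (i j r : ℤ) :
    (M : ℤ) • c + ![i, j] + r • stepVec ((0 : Fin 2), true) = (M : ℤ) • c + ![i + r, j] := by
  rw [smul_stepVec_right, base_add_add, add_zero]
/-- Position after `r` steps UP from `M c + (i, j)`. [folklore] -/
theorem base_add_smul_up (M : ℕ) (c : Site 2) (i j r : ℤ) :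
    (M : ℤ) • c + ![i, j] + r • stepVec ((1 : Fin 2), true) = (M : ℤ) • c + ![i, j + r] := by
  rw [smul_stepVec_up, base_add_add, add_zero]
/-- Position after `r` steps DOWN from `M c + (i, j)`. [folklore] -/
theorem base_add_smul_down (M : ℕ) (c : Site 2) (i j r : ℤ) :
    (M : ℤ) • c + ![i, j] + r • stepVec ((1 : Fin 2), false) = (M : ℤ) • c + ![i, j - r] := by
  rw [smul_stepVec_down, base_add_add, add_zero, ← sub_eq_add_neg]
/-- Position after `r` steps LEFT from `M c + (i, j)`. [folklore] -/
theorem base_add_smul_left (M : ℕ) (c : Site 2) (i j r : ℤ) :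
    (M : ℤ) • c + ![i, j] + r • stepVec ((0 : Fin 2), false) = (M : ℤ) • c + ![i - r, j] := by
  rw [smul_stepVec_left, base_add_add, add_zero, ← sub_eq_add_neg]


end Summit.CriticalPhenomena.PercolationContinuityZ3.Theorems.TransplantSharpness
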